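import Literature.NumberTheory.EllipticCurves.Kato2004.EulerSystemBoundFineSelmerTwo
import HarnessLib

/-!
# Kato 2004 (Astérisque 295) Thm. 13.4 (2) at `p = 2` for `T = T₂W` — the PRINT-EXACT reading on the
# pinned `(𝐇¹_Γ(T₂W), X₀(W/ℚ_∞))`: the dual fine Selmer group with its CONTRAGREDIENT `Λ`-structure
# (`FB : W.FineSelmerDualData κ γ⁻¹` against `I : IwasawaH1Data W 2 κ γ`, SAME height-one prime `𝔭 ∌ 2`)

Topic `NumberTheory/EllipticCurves`, sub-directory `Kato2004` (namespace = path). Sibling of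
`EulerSystemBoundFineSelmerTwo` (cell `bsd-wall`, seat `bsd-wall-tp2-p2x` g0), whose vocabulary
(`IsEulerSystemClassTwo`, `levelToLayerTwo`, the pinned data) is used unchanged. THIS FILE: ONE named
fact (`def … : Prop`, D-0014; nothing asserted, no `_holds`) and one unfolding lemma; no instance, no
notation, no attribute. Typed by a Literature typer (cell `bsd-stepL`, guest service) at the request of
the cell `bsd-wall` (crux K3 `SignedKatoDivisibilityUpToAtTwo`, item stmt-BirchSwinnertonDyer-20308:
convention audit `Cruxes/SignedKatoDivisibilityUpToAtTwo/G4-CONVENTION-AUDIT.md` §3 (b) and its second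
reader `W3G2-READER-G4-AUDIT.md`, 2026-08-28: "print-exact retype = `Y : FineSelmerDualData κ γ⁻¹` against
`I : IwasawaH1Data W 2 κ γ`"). HONEST FRAMING: a TRANSCRIPTION; Kato's theorem is not proved here; BSD is
not proved by any of this; nothing is booked.

## Why a second transcription (the `Λ`-module structure on a Pontryagin dual)

Kato's objects are `𝐇^q(T) = lim←_n H^q(ℤ[ζ_{p^n}, 1/p], T)` [§12.2, p. 220], `Λ = O_L[[G_∞]]`-modules
through the natural action of `G_∞` on the étale cohomology of the layers ("`𝐇¹(T)` and `𝐇²(T)` are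
finitely generated `ℤ_p[[G_∞]]`-modules" (12.2.1)); Thm. 13.4 (2) compares `𝐇²(T)₀` and `𝐇¹(T)/Z` AT THE
SAME prime `𝔭`, both with that action. The tree pins `𝐇¹` as `I : Kato2004.IwasawaH1Data W p κ γ`, on which
`T ∈ Λ = ℤ_p⟦T⟧` acts as `conj_γ − 1` with `(conj_σ φ)(x) = σ • φ(σ⁻¹ x σ)` (`IwasawaH1Data.proj_T_smul`,
`conjMap`): the natural (covariant) action, `1 + T ↦ γ`. The tree pins the dual fine Selmer group as
`FB : W.FineSelmerDualData κ γ'`, an abstract `Λ`-module with `toDual : FB.X ≃ Hom(Sel₀(ℚ_∞, E[p^∞]), ℚ/ℤ)`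
along which `T` acts by PRE-COMPOSITION with `conj_{γ'}`: `toDual (T • x) s = toDual x (conj_{γ'} s) −
toDual x s` (`FineSelmerDualData.toDual_T_smul`; `conjH1` is the same covariant action on
`H¹(ℚ_∞, E[p^∞])`). The sibling's reading flag `Kato-134-H20-fine` identifies the `Δ`-trivial component
of `𝐇²(T₂W)₀` with `X₀(W/ℚ_∞) = Hom(Sel₀(ℚ_∞, E[2^∞]), ℚ₂/ℤ₂)` through Poitou–Tate duality along the
tower [Kato (14.9.1)–(14.9.3), p. 239, and (17.13.1), p. 279: "a sequence of `Λ`-modules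
`… → X(T^*(1 − k)) → 𝐇²(T(k)) → …`" obtained "by taking `lim←_n` of the sequence (14.9.3)"]. The
duality pairing is FUNCTORIAL in the pair (Galois group, module), in particular invariant under transport
of structure by any `σ ∈ Gal(ℚ̄/ℚ)` (which permutes the local summands): `⟨σ a, σ b⟩ = ⟨a, b⟩`. Hence the
duality isomorphism carries the natural action of `σ` on `𝐇²` to the CONTRAGREDIENT action
`x ↦ x ∘ conj_{σ⁻¹}` on the Pontryagin dual (Greenberg's convention issue: for a `Λ`-module `S`, "`S^ι` is
the `Λ`-module with the same underlying set as `S` but with `Λ` acting through `ι`", `ι(γ) = γ⁻¹`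
[Greenberg1989, §0 before Thm. 2, pp. 101–102]; pre-composition = contragredient ∘ `ι`). With
`1 + T ↦ γ` on BOTH sides, Kato's `𝐇²(T)₀` is therefore the datum whose `T` acts by
`x ↦ x ∘ conj_{γ⁻¹} − x`, i.e. EXACTLY `FB : W.FineSelmerDualData κ γ⁻¹` — while the sibling fact
`thm13_4_two_lengthAt_fineSelmerDual_le_of_isEulerSystemClassTwo` takes `FB : W.FineSelmerDualData κ γ`,
i.e. `(X₀)^ι`, and so transcribes `ℓ_{ι𝔭}(X₀) ≤ ℓ_𝔭(𝐇¹/Λs)` = print ∘ `ι` on one side. The two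
transcriptions differ by the statement «`char_Λ(𝐇¹(T₂W)/Λs)` (equivalently `char_Λ X₀`) is `ι`-symmetric
prime by prime», which is NOT in print for the fine Selmer group (Greenberg's algebraic functional equation
[GreenbergLNM1716, Thm. 1.14 (p. 68)] is for the ordinary Selmer group). The sibling is NOT edited (D-0014:
a fact's meaning is never changed in place); this file vendors the print-exact reading under a new name.
READING FLAG `Kato-134-dual-action` (the only new one; for the referee): the derivation above (functoriality
of Poitou–Tate duality ⇒ contragredient action on the dual) — two concurring readers in the requesting
cell (files cited above); all other flags (`Kato-134-two-Delta`, `Kato-134-H20-fine`, `Kato-134-J-quotient`,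
`Kato-134-i-two`, `Kato-134-levels`) are the sibling's, VERBATIM.

## Relation to the registered consumer shape

The cell `bsd-wall` registered the `ι𝔭`-spelling (K2^ι: `FB` over `γ`, the `𝐇¹`-side length read at
`PrimeSpectrum.comap (IwasawaAlgebra.invol 2).toRingHom 𝔭`) as the stub `stub_katoBoundTwoInv` of
`Cruxes/SignedKatoDivisibilityUpToAtTwo/Lines/colemanrat.lean` v5, and PROVED in the kernel that it is
equivalent to the present spelling (`Summits/…/Theorems/ThetaPartnerAtTwoSignedKatoUpToAtTwoKatoBoundTwist.lean`,
`katoBoundTwoInv_of_contra` / `contra_of_katoBoundTwoInv`, whose hypothesis `hK2` is the body below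
VERBATIM). This file chooses the `γ⁻¹`-datum spelling because it needs no involution in the statement and
reads both sides at the same `𝔭`, as printed.

## Source, verbatim (K. Kato, Astérisque 295 (2004); held copy `paper:url-37fbba0bb64a`, PDF page =
## printed page − 115; re-read for this file 2026-08-28: pp. 220–222, 226, 239, 273, 279–280)

§12.2 (p. 220): "Let `T` be a finitely generated `ℤ_p`-module endowed with a continuous action of
`Gal(ℚ̄/ℚ)` which is unramified at almost all prime numbers. We denote for `q ∈ ℤ`
`𝐇^q(T) = lim←_n H^q(ℤ[ζ_{p^n}, 1/p], T)` where `H^q` is the etale cohomology as in 8.2, and the inverse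
limit is taken with respect to trace maps. The following are known: (12.2.1) `𝐇^q(T) = 0` if `q ≠ 1, 2`
and `𝐇¹(T)` and `𝐇²(T)` are finitely generated `ℤ_p[[G_∞]]`-modules." **Thm. 13.4** (p. 226): "Let
`(T, L, Σ)` be as in 13.1, and let `(z_m)_m` be an Euler system for `(T, L, Σ)`. Let `Λ = O_L[[G_∞]]`, let
`Z` be the `Λ`-submodule of `𝐇¹(T)` generated by `(z_{p^n})_n`, and let `J` be the ideal of `Λ` generated
by `h(Z)` for all `Λ`-homomorphisms `h : 𝐇¹(T) → Λ`. On the other hand, let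
`𝐇²(T)₀ = Ker(𝐇²(T) → 𝐇²_loc(T))`. Assume the following (i)–(v). […] Then we have: (1) `𝐇²(T)` is a
torsion `Λ`-module. (2) Let `𝔭` be a prime ideal of `Λ` of height one which does not contain `p`. Then
`length_{Λ_𝔭}(𝐇²(T)_{0,𝔭}) ≤ length_{Λ_𝔭}(Λ_𝔭/J_𝔭)`. (3) […] Assume further `p ≠ 2`. […]" §14.9
(p. 239): "By the duality theory of Poitou-Tate [Ta1, Ma2], we have sequences of `O_L`-modules (14.9.1)
[…] (14.9.2) […] (`T^* = Hom_{O_L}(T, O_L)` endowed with the dual action of `Gal(K̄/K)`, and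
`{ }^∨ = Hom_{O_L}( , L/O_L)`), which are exact in the case `p ≠ 2`, and exact upto `×2` in the case
`p = 2`." §17.3 (p. 273): "`X(T) = Hom_{O_λ}(Sel_∞(T), F_λ/O_λ)`. We regard `X(T)` as a module over
`Λ = O_λ[[G_∞]]` in the natural way." §17.13 (p. 279): "By taking `lim←_n` of the sequence (14.9.3) for
`K = ℚ(ζ_{p^n})` […] we obtain a sequence of `Λ`-modules (17.13.1)
`0 → 𝐇¹(T(k))/… → 𝐇¹_loc(T(k))/… → X(T^*(1 − k)) → 𝐇²(T(k)) → 𝐇²_loc(T(k))` […] which is exact if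
`p ≠ 2`, and is exact upto `×2` in the case `p = 2`."
R. Greenberg, Adv. Stud. Pure Math. 17 (1989) pp. 101–102 [Greenberg1989]: "Now we have an automorphism
`ι` of `Λ` induced from the automorphism `γ → γ⁻¹` of `Γ`. If `S` is any `Λ`-module, we define `S^ι` as
the `Λ`-module with the same underlying set as `S` but with `Λ` acting through `ι`. […] Theorem 2. Assume
`L_V(1)` and `L_{V^*}(1)` are critical values and that `S_{V_p/T_p}(ℚ_∞)` is `Λ`-cotorsion. Then
`S_{V_p/T_p}(ℚ_∞)` and `S_{V^*_p/T^*_p}(ℚ_∞)^ι` have the same characteristic ideal."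

## What is NOT here (and why)

* NO edit of the sibling fact; NO claim that the sibling and the present fact are equivalent (they differ
  by an unprinted `ι`-symmetry); NO `IwasawaAlgebra.invol` in the statement (the `ι𝔭`-spelling is the
  consumer's kernel corollary, see above).
* NO clause (3) / Thm. 12.5 (4), nothing at the prime `(2)` of `Λ` — as in the sibling.
* NO `_holds` (Kato §13 = the Euler-system machinery; size XL).
-- TODO(general form): as in the sibling — arbitrary lattices `T` as in 13.1 over the full `O_L[[G_∞]]`,
-- both `Δ`-components, non-cyclic `Z`; and the same print-exact retype of the odd-`p` sibling
-- `thm13_4_lengthAt_fineSelmerDual_le_of_isEulerSystemClass` (cell `bsd-potss`), not done here.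

References: [Kato2004Asterisque] §12.2 (p. 220), Thm. 12.4 (2) (p. 221), Thm. 13.4 (2) (p. 226), §13.1,
Ex. 13.3 (pp. 224–225), Prop. 13.7 (p. 227), §14.9 (14.9.1)–(14.9.3) (p. 239), §17.3 (p. 273), §17.13
(17.13.1) (p. 279); [Greenberg1989] §0 pp. 101–102 (the module `S^ι`, Thm. 2); [GreenbergLNM1716] §1
p. 60, Thm. 1.14 (p. 68); [Washington1997] §13.1–13.2; tree: `Kato2004/EulerSystemBoundFineSelmerTwo.lean`
(sibling, all flags), `Kato2004/IwasawaCohomology.lean` (`IwasawaH1Data.proj_T_smul`),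
`KatoFineSelmerDual.lean` (`FineSelmerDualData.toDual_T_smul`), `IwasawaAlgebraInvolution.lean` (`ι`).
-/

noncomputable section

open scoped NumberField
open Field IsDedekindDomain
open Literature.NumberTheory.GaloisRepresentations
open Literature.NumberTheory.EllipticCurves Literature.NumberTheory.EllipticCurves.Kato2004.EulerSystemValues

namespace Literature.NumberTheory.EllipticCurves.Kato2004

/-- **Kato 2004, Thm. 13.4 (2) at `p = 2` for `T = T₂W`, PRINT-EXACT on the pinned data: the dual fine
Selmer group with its CONTRAGREDIENT `Λ`-structure.** For every elliptic curve `W/ℚ` WITHOUT complex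
multiplication (hypothesis (v) for `T₂W`, tree `Kato2004.exists_finrank_coker_eq_one_of_not_hasCM`;
(ii)–(iv) in print; any reduction at `2`; structure facts of `T₂W` as instance BINDERS), the cyclotomic
`ℤ₂`-extension `κ` with topological generator `γ` (`κ γ = 1`), every pinned `I : IwasawaH1Data W 2 κ γ`
(`𝐇¹_Γ(T₂W)`, `T` acting as `conj_γ − 1`, covariant: `1 + T ↦ γ`) and every pinned
`FB : W.FineSelmerDualData κ γ⁻¹` (`X₀(W/ℚ_∞) = Hom(Sel₀(ℚ_∞, E[2^∞]), ℚ₂/ℤ₂)` with `T` acting as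
`x ↦ x ∘ conj_{γ⁻¹} − x`, the CONTRAGREDIENT action of `γ` minus one — the structure carried to the
natural action on `𝐇²(T)₀` by Poitou–Tate duality, flag `Kato-134-dual-action` of the module docstring),
and every GENUINE `2`-adic Λ-adic Euler-system class `s ∈ 𝐇¹_Γ(T₂W)` (`IsEulerSystemClassTwo`) with
`s ≠ 0`: at every height-one prime `𝔭` of `Λ = ℤ₂⟦X⟧` with `2 ∉ 𝔭`,
`ℓ_𝔭(X₀(W/ℚ_∞)) ≤ ℓ_𝔭(𝐇¹_Γ(T₂W)/Λs)` — "`length_{Λ_𝔭}(𝐇²(T)_{0,𝔭}) ≤ length_{Λ_𝔭}(Λ_𝔭/J_𝔭)`", both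
sides at the SAME `𝔭`, as printed. VERBATIM the sibling
`thm13_4_two_lengthAt_fineSelmerDual_le_of_isEulerSystemClassTwo` except for the generator argument
`γ⁻¹` of the fine dual datum (the sibling, with `γ` there, reads `ℓ_{ι𝔭}(X₀) ≤ ℓ_𝔭(𝐇¹/Λs)` = print ∘ `ι`;
the two differ by an unprinted `ι`-symmetry of `char(𝐇¹/Λs)`). ONLY clause (2); flags
`Kato-134-two-Delta`, `Kato-134-H20-fine`, `Kato-134-J-quotient`, `Kato-134-i-two` of the sibling apply
verbatim. Named fact; nothing asserted; no `_holds` (size XL).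
[cite: Kato2004Asterisque, Thm. 13.4 (2) (p. 226), §12.2 (12.2.1) (p. 220), §13.1 and Ex. 13.3 (pp. 224–225), Prop. 13.7 (p. 227), §14.9 (14.9.1)–(14.9.3) (p. 239), §17.13 (17.13.1) (p. 279)]
[cite: Greenberg1989, §0 pp. 101–102 (the Λ-module S^ι, ι(γ) = γ⁻¹, and Thm. 2)]
[cite: GreenbergLNM1716, §1 p. 60 and Thm. 1.14 (p. 68)] [cite: Washington1997, §13.1–13.2] -/
def thm13_4_two_lengthAt_fineSelmerDualContra_le_of_isEulerSystemClassTwo : Prop :=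
  ∀ (W : WeierstrassCurve ℚ) [W.IsElliptic], ¬ W.HasCM →
    ∀ [ContinuousSMul ℤ_[2] (W.tateModule 2)] [Module.Free ℤ_[2] (W.tateModule 2)]
      [Module.Finite ℤ_[2] (W.tateModule 2)]
      (κ : ZpExtension ℚ 2) (γ : absoluteGaloisGroup ℚ) (hκ : κ.IsCyclotomic), κ.IsTopGenerator γ →
    ∀ (I : IwasawaH1Data W 2 κ γ) (FB : W.FineSelmerDualData κ γ⁻¹) (s : I.H),
      IsEulerSystemClassTwo W hκ I s → s ≠ 0 →
      ∀ 𝔭 : PrimeSpectrum (IwasawaAlgebra 2), 𝔭.asIdeal.height = 1 →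
        PowerSeries.C (2 : ℤ_[2]) ∉ 𝔭.asIdeal →
          Module.lengthAt (IwasawaAlgebra 2) FB.X 𝔭 ≤
            Module.lengthAt (IwasawaAlgebra 2) (I.H ⧸ Submodule.span (IwasawaAlgebra 2) {s}) 𝔭

/-- Unfolding: the fact with the Euler-system clause `IsEulerSystemClassTwo` written out (a finite bad
set `S`, an integral Euler system `z` for `T₂W` over the cyclotomic levels away from `S`, and
`proj n s = Cor_{ℚ(μ_{2^{n+2}})/ℚ_n}(z_{n+2,∅})` for every `n`) — the shape in which consumers that do
not open this namespace quote Kato's hypothesis. [cite: Kato2004Asterisque, §13.1 (13.1.1) and Thm. 13.4 (2) (pp. 224–226)] -/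
theorem thm13_4_two_lengthAt_fineSelmerDualContra_le_iff :
    thm13_4_two_lengthAt_fineSelmerDualContra_le_of_isEulerSystemClassTwo ↔
      ∀ (W : WeierstrassCurve ℚ) [W.IsElliptic], ¬ W.HasCM →
        ∀ [ContinuousSMul ℤ_[2] (W.tateModule 2)] [Module.Free ℤ_[2] (W.tateModule 2)]
          [Module.Finite ℤ_[2] (W.tateModule 2)]
          (κ : ZpExtension ℚ 2) (γ : absoluteGaloisGroup ℚ) (hκ : κ.IsCyclotomic), κ.IsTopGenerator γ →
        ∀ (I : IwasawaH1Data W 2 κ γ) (FB : W.FineSelmerDualData κ γ⁻¹) (s : I.H),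
          (∃ (S : Set (HeightOneSpectrum (𝓞 ℚ))) (_ : S.Finite)
              (z : ∀ (k : ℕ) (r : (cyclotomicLevelsRat 2 S).Ideals),
                H1 (tateRep W 2) ((cyclotomicLevelsRat 2 S).level k r.1)),
              IsEulerSystem (cyclotomicLevelsRat 2 S) (tateRep W 2) 2 z ∧
              (∀ (k : ℕ) (r : (cyclotomicLevelsRat 2 S).Ideals),
                z k r ∈ integralH1 (tateRep W 2) 2 ((cyclotomicLevelsRat 2 S).level k r.1)) ∧
              ∀ n : ℕ, I.proj n s =
                levelToLayerTwo W hκ S n (z (n + 2) (cyclotomicLevelsRat 2 S).idealOne)) →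
          s ≠ 0 →
          ∀ 𝔭 : PrimeSpectrum (IwasawaAlgebra 2), 𝔭.asIdeal.height = 1 →
            PowerSeries.C (2 : ℤ_[2]) ∉ 𝔭.asIdeal →
              Module.lengthAt (IwasawaAlgebra 2) FB.X 𝔭 ≤
                Module.lengthAt (IwasawaAlgebra 2) (I.H ⧸ Submodule.span (IwasawaAlgebra 2) {s}) 𝔭 :=
  Iff.rfl

end Literature.NumberTheory.EllipticCurves.Kato2004

end
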